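import Mathlib.Analysis.Calculus.ContDiff.Basic
import Mathlib.Analysis.Calculus.ContDiff.Operations
import Mathlib.Analysis.InnerProductSpace.PiL2
import HarnessLib

/-!
# Route OddMorawetz — `MorawetzKillsTypeI`, jet of the reflected field
(item stmt-NavierStokesRegularity-1377, stub `stub_reflect_jet`)

The spatial reflection `P v (x) := −v(−x)` used to kill even derivative weights in the
Morawetz-certificate argument acts on jets by a sign: for every `v : ℝ³ → ℝ³`, every order `n`
and every point `x`,
`iteratedFDeriv ℝ n (P v) x = (-1) ^ (n + 1) • iteratedFDeriv ℝ n v (-x)`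
as continuous multilinear maps. No smoothness hypothesis is needed: `P v = -(v ∘ neg)` with
`neg = ContinuousLinearEquiv.neg ℝ`, the iterated derivative of a negation is the negation
(`iteratedFDeriv_neg_apply`), precomposition with a continuous linear equivalence commutes with
`iteratedFDerivWithin` unconditionally (`ContinuousLinearEquiv.iteratedFDerivWithin_comp_right`),
and precomposing an `n`-multilinear map with `neg` in every slot multiplies it by `(-1) ^ n`
(`ContinuousMultilinearMap.map_smul_univ`).
-/

set_option linter.dupNamespace false

namespace Summit.NavierStokesRegularity.NavierStokesRegularity.Theorems

/-- Precomposing a continuous multilinear map in `n` variables with the negation map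
`ContinuousLinearEquiv.neg ℝ` in every slot multiplies it by `(-1) ^ n`. -/
theorem compContinuousLinearMap_neg_eq_pow_smul {E F : Type*} [NormedAddCommGroup E]
    [NormedSpace ℝ E] [NormedAddCommGroup F] [NormedSpace ℝ F] {n : ℕ}
    (A : ContinuousMultilinearMap ℝ (fun _ : Fin n => E) F) :
    A.compContinuousLinearMap
        (fun _ => ((ContinuousLinearEquiv.neg ℝ : E ≃L[ℝ] E) : E →L[ℝ] E)) =
      (-1 : ℝ) ^ n • A := by
  ext h
  simp only [ContinuousMultilinearMap.compContinuousLinearMap_apply,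
    ContinuousLinearEquiv.coe_coe, ContinuousLinearEquiv.neg_apply, smul_apply]
  have hneg : (fun i => -h i) = fun i => (-1 : ℝ) • h i := by
    funext i
    rw [neg_one_smul]
  rw [hneg, A.map_smul_univ, Finset.prod_const, Finset.card_univ, Fintype.card_fin]

/-- **Jet of the reflected field** (item stmt-NavierStokesRegularity-1377, route OddMorawetz,
stub `stub_reflect_jet`): for every `v : ℝ³ → ℝ³`, every `n : ℕ` and every `x : ℝ³`,
`Dⁿ(fun x ↦ -v (-x)) x = (-1) ^ (n + 1) • Dⁿ v (-x)`. No smoothness is assumed (off the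
differentiability locus both sides are the junk value, consistently). -/
theorem stub_reflect_jet :
    ∀ (n : ℕ) (v : EuclideanSpace ℝ (Fin 3) → EuclideanSpace ℝ (Fin 3))
      (x : EuclideanSpace ℝ (Fin 3)),
      iteratedFDeriv ℝ n (fun x => -v (-x)) x =
        (-1 : ℝ) ^ (n + 1) • iteratedFDeriv ℝ n v (-x) := by
  intro n v x
  have hfun : (fun x => -v (-x)) =
      -(v ∘ ⇑(ContinuousLinearEquiv.neg ℝ :
        EuclideanSpace ℝ (Fin 3) ≃L[ℝ] EuclideanSpace ℝ (Fin 3))) := by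
    funext y
    simp only [Pi.neg_apply, Function.comp_apply, ContinuousLinearEquiv.neg_apply]
  have key := (ContinuousLinearEquiv.neg ℝ :
      EuclideanSpace ℝ (Fin 3) ≃L[ℝ] EuclideanSpace ℝ (Fin 3)).iteratedFDerivWithin_comp_right
    v uniqueDiffOn_univ (Set.mem_univ _) n (x := x)
  rw [Set.preimage_univ, iteratedFDerivWithin_univ, iteratedFDerivWithin_univ,
    ContinuousLinearEquiv.neg_apply, compContinuousLinearMap_neg_eq_pow_smul] at key
  rw [hfun, iteratedFDeriv_neg_apply, key, pow_succ, mul_neg_one, neg_smul]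

end Summit.NavierStokesRegularity.NavierStokesRegularity.Theorems
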